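import Summits.Ventures.LatticeQCDFlow.Scoring.SchwingerDysonFreePropagator
import HarnessLib

/-!
# Wick's theorem for the four-point function of the free lattice field, from Schwinger–Dyson alone, and the interacting four-point hierarchy equation

HONEST FRAMING: exact (Metropolis-corrected) sampling algorithms for lattice gauge theory;
figures of merit are autocorrelation/cost numbers at stated couplings and volumes; no
continuum-physics claim.  (SCALAR calibration rung S0-A: not a gauge result.)

Venture `LatticeQCDFlow` (cell pub-lqcd), sub-topic `Scoring`; FANOUT row 2 (`s0-phi4`).  NEW WORK
of the cell.  Eighth file of the φ⁴ Schwinger–Dyson series.  The monomial identity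
`⟨(Πφ^k) ∂_xS⟩ = k_x ⟨Πφ^{k[x↦k_x−1]}⟩` (`gibbs_sd_monomial_of_coercive`) is turned into a PRODUCT
RULE (`deriv_monomial_mul_site`: raising the exponent at `y` by one adds `δ_{xy}` times the old
monomial to the derivative) and read at degree three:

* `gibbs_sd_three_of_coercive` — `⟨φ_b φ_c φ_d ∂S/∂φ_x⟩ = δ_{bx}⟨φ_cφ_d⟩ + δ_{cx}⟨φ_bφ_d⟩ +
  δ_{dx}⟨φ_bφ_c⟩` (any real `λ`, `J` under coercivity);
* **`gibbs_four_point_sd_of_coercive`** / `gibbs_four_point_sd` (`λ > 0`, any `J`) — the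
  four-point equation of the Schwinger–Dyson hierarchy,
  `Σ_z (J_{xz} + J_{zx}) ⟨φ_z φ_b φ_c φ_d⟩ + 4λ ⟨φ_x³ φ_b φ_c φ_d⟩
     = δ_{bx} G_{cd} + δ_{cx} G_{bd} + δ_{dx} G_{bc}`,  `G_{zy} = ⟨φ_zφ_y⟩`
  (an exact linear relation between the measured 4-point and 6-point insertions, reference-free);
* **`wick_four_point`** (`λ = 0`, `J + Jᵀ ≽ 2ε > 0`) — **Wick's theorem**
  `⟨φ_a φ_b φ_c φ_d⟩ = G_{ab}G_{cd} + G_{ac}G_{bd} + G_{ad}G_{bc}`, obtained by contracting the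
  hierarchy equation with `G = (J + Jᵀ)⁻¹` (`free_propagator_mul`, `mul_eq_one_comm`) —
  no Gaussian integral is computed.  For the engine's free field (`m² > 0`) this is the population
  statement behind fourth-moment free-field checks (e.g. a vanishing Binder-type combination
  `⟨M⁴⟩ − 3⟨M²⟩²` for any linear functional `M`, by multilinearity).

NOT here: the `2k`-point Wick formula for `k ≥ 3` (same induction, not needed by the battery);
statistical power (numerics gate).
-/

namespace Summit.Ventures.LatticeQCDFlow.Scoring

open Real MeasureTheory Set Filter Finset

section Wick

variable {n : ℕ}

/-! ## The product rule on multi-indices -/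

/-- **Product rule.**  Raising the exponent of a monomial at `y` by one, the Schwinger–Dyson
derivative term `k_x Π φ^{k[x ↦ k_x−1]}` changes by the Leibniz rule:
`k'_x Π φ^{k'[x↦k'_x−1]} = (k_x Π φ^{k[x↦k_x−1]}) φ_y + δ_{xy} Π φ^k` for `k' = k[y ↦ k_y + 1]`. -/
theorem deriv_monomial_mul_site (φ : Fin (n + 1) → ℝ) (k : Fin (n + 1) → ℕ)
    (x y : Fin (n + 1)) :
    ((Function.update k y (k y + 1) x : ℕ) : ℝ) *
        ∏ w, φ w ^ Function.update (Function.update k y (k y + 1)) x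
          (Function.update k y (k y + 1) x - 1) w
      = (k x : ℝ) * (∏ w, φ w ^ Function.update k x (k x - 1) w) * φ y
        + (if y = x then (1 : ℝ) else 0) * ∏ w, φ w ^ k w := by
  by_cases hxy : y = x
  · subst hxy
    rw [if_pos rfl, one_mul, Function.update_self, Function.update_idem, Nat.add_sub_cancel,
      Function.update_eq_self]
    rcases Nat.eq_zero_or_pos (k y) with h0 | hpos
    · rw [h0]
      push_cast
      ring
    · have e1 : (∏ w, φ w ^ Function.update k y (k y - 1) w) * φ y = ∏ w, φ w ^ k w := by
        rw [← pow_one (φ y), prod_pow_mul_pow, Function.update_self, Function.update_idem,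
          Nat.sub_add_cancel hpos, Function.update_eq_self]
      rw [mul_assoc, e1]
      push_cast
      ring
  · have hxy' : x ≠ y := fun h => hxy h.symm
    rw [if_neg hxy, zero_mul, add_zero, Function.update_of_ne hxy', Function.update_comm hxy]
    have e : Function.update (Function.update k x (k x - 1)) y (k y + 1)
        = Function.update (Function.update k x (k x - 1)) y
            (Function.update k x (k x - 1) y + 1) := by
      rw [Function.update_of_ne hxy]
    rw [e, ← prod_pow_mul_pow, pow_one, mul_assoc]

/-! ## Integrability of the degree-3 and degree-4 observables -/

/-- Integrability of `φ_x^m φ_b φ_c φ_d e^{−S}` under coercivity (`m = 1`: the 4-point density;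
`m = 3`: the quartic insertion of the hierarchy equation). -/
theorem integrable_four_mul_gibbsWeight_of_coercive {J : Fin (n + 1) → Fin (n + 1) → ℝ}
    {lam ε K : ℝ} (hε : 0 < ε)
    (hS : ∀ φ : Fin (n + 1) → ℝ, ε * ∑ w, φ w ^ 2 - K ≤ latticePhi4Action J lam φ)
    (x b c d : Fin (n + 1)) (m : ℕ) :
    Integrable (fun φ : Fin (n + 1) → ℝ =>
      φ x ^ m * φ b * φ c * φ d * gibbsWeight J lam φ) := by
  set K1 : Fin (n + 1) → ℕ := Function.update (fun _ => 0) x m with hK1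
  set K2 : Fin (n + 1) → ℕ := Function.update K1 b (K1 b + 1) with hK2
  set K3 : Fin (n + 1) → ℕ := Function.update K2 c (K2 c + 1) with hK3
  set K4 : Fin (n + 1) → ℕ := Function.update K3 d (K3 d + 1) with hK4
  refine (integrable_monomial_mul_gibbsWeight_of_coercive hε hS K4).congr
    (Eventually.of_forall fun φ => ?_)
  dsimp only
  rw [hK4, ← prod_pow_mul_pow, hK3, ← prod_pow_mul_pow, hK2, ← prod_pow_mul_pow, hK1,
    prod_pow_single]
  simp only [pow_one]

/-- Integrability of `φ_b φ_c φ_d F_x e^{−S}` under coercivity. -/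
theorem integrable_three_mul_force_mul_gibbsWeight_of_coercive {J : Fin (n + 1) → Fin (n + 1) → ℝ}
    {lam ε K : ℝ} (hε : 0 < ε)
    (hS : ∀ φ : Fin (n + 1) → ℝ, ε * ∑ w, φ w ^ 2 - K ≤ latticePhi4Action J lam φ)
    (b c d x : Fin (n + 1)) :
    Integrable (fun φ : Fin (n + 1) → ℝ =>
      φ b * φ c * φ d * latticePhi4Force J lam φ x * gibbsWeight J lam φ) := by
  set K1 : Fin (n + 1) → ℕ := Function.update (fun _ => 0) b 1 with hK1
  set K2 : Fin (n + 1) → ℕ := Function.update K1 c (K1 c + 1) with hK2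
  set K3 : Fin (n + 1) → ℕ := Function.update K2 d (K2 d + 1) with hK3
  refine (integrable_monomial_mul_force_mul_gibbsWeight_of_coercive hε hS K3 x).congr
    (Eventually.of_forall fun φ => ?_)
  dsimp only
  rw [hK3, ← prod_pow_mul_pow, hK2, ← prod_pow_mul_pow, hK1, prod_pow_single]
  simp only [pow_one]

/-! ## The three-point Schwinger–Dyson identity -/

/-- **`⟨φ_b φ_c φ_d ∂S/∂φ_x⟩ = δ_{bx}⟨φ_cφ_d⟩ + δ_{cx}⟨φ_bφ_d⟩ + δ_{dx}⟨φ_bφ_c⟩`**, under coercivity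
(any real `λ`, `J`; coincident sites allowed). -/
theorem gibbs_sd_three_of_coercive {J : Fin (n + 1) → Fin (n + 1) → ℝ} {lam ε K : ℝ}
    (hε : 0 < ε) (hS : ∀ φ : Fin (n + 1) → ℝ, ε * ∑ w, φ w ^ 2 - K ≤ latticePhi4Action J lam φ)
    (x b c d : Fin (n + 1)) :
    gibbsExpect J lam (fun φ => φ b * φ c * φ d * latticePhi4Force J lam φ x)
      = (if b = x then (1 : ℝ) else 0) * gibbsExpect J lam (fun φ => φ c * φ d)
        + (if c = x then (1 : ℝ) else 0) * gibbsExpect J lam (fun φ => φ b * φ d)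
        + (if d = x then (1 : ℝ) else 0) * gibbsExpect J lam (fun φ => φ b * φ c) := by
  set K0 : Fin (n + 1) → ℕ := fun _ => 0 with hK0
  set K1 : Fin (n + 1) → ℕ := Function.update K0 b (K0 b + 1) with hK1
  set K2 : Fin (n + 1) → ℕ := Function.update K1 c (K1 c + 1) with hK2
  set K3 : Fin (n + 1) → ℕ := Function.update K2 d (K2 d + 1) with hK3
  -- the monomials
  have e0 : ∀ φ : Fin (n + 1) → ℝ, ∏ w, φ w ^ K0 w = 1 := by
    intro φ; rw [hK0]; simp
  have e1 : ∀ φ : Fin (n + 1) → ℝ, ∏ w, φ w ^ K1 w = φ b := by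
    intro φ; rw [hK1, ← prod_pow_mul_pow, e0, pow_one, one_mul]
  have e2 : ∀ φ : Fin (n + 1) → ℝ, ∏ w, φ w ^ K2 w = φ b * φ c := by
    intro φ; rw [hK2, ← prod_pow_mul_pow, e1, pow_one]
  have e3 : ∀ φ : Fin (n + 1) → ℝ, ∏ w, φ w ^ K3 w = φ b * φ c * φ d := by
    intro φ; rw [hK3, ← prod_pow_mul_pow, e2, pow_one]
  have hK0x : ((K0 x : ℕ) : ℝ) = 0 := by rw [hK0]; simp
  -- the derivative side, pointwise, by the product rule three times
  have eD : (fun φ : Fin (n + 1) → ℝ =>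
      (K3 x : ℝ) * ∏ w, φ w ^ Function.update K3 x (K3 x - 1) w)
      = fun φ => (if b = x then (1 : ℝ) else 0) * (φ c * φ d)
          + (if c = x then (1 : ℝ) else 0) * (φ b * φ d)
          + (if d = x then (1 : ℝ) else 0) * (φ b * φ c) := by
    funext φ
    have hA3 := deriv_monomial_mul_site φ K2 x d
    have hA2 := deriv_monomial_mul_site φ K1 x c
    have hA1 := deriv_monomial_mul_site φ K0 x b
    rw [← hK3] at hA3
    rw [← hK2] at hA2
    rw [← hK1] at hA1
    rw [hA3, hA2, hA1, hK0x, e0, e1, e2]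
    ring
  have eM : (fun φ : Fin (n + 1) → ℝ => (∏ w, φ w ^ K3 w) * latticePhi4Force J lam φ x)
      = fun φ => φ b * φ c * φ d * latticePhi4Force J lam φ x := by
    funext φ; rw [e3]
  -- integrability of the three two-point densities
  have hI : ∀ (y z : Fin (n + 1)) (cst : ℝ), Integrable (fun φ : Fin (n + 1) → ℝ =>
      cst * (φ y * φ z) * gibbsWeight J lam φ) := by
    intro y z cst
    refine ((integrable_pow_mul_pow_mul_gibbsWeight_of_coercive hε hS y z 1 1).const_mul cst).congr
      (Eventually.of_forall fun φ => ?_)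
    simp only [pow_one]
    ring
  have hI12 : Integrable (fun φ : Fin (n + 1) → ℝ =>
      ((if b = x then (1 : ℝ) else 0) * (φ c * φ d) + (if c = x then (1 : ℝ) else 0) * (φ b * φ d))
        * gibbsWeight J lam φ) := by
    refine ((hI c d (if b = x then (1 : ℝ) else 0)).add
      (hI b d (if c = x then (1 : ℝ) else 0))).congr (Eventually.of_forall fun φ => ?_)
    simp only [Pi.add_apply]
    ring
  have h := gibbs_sd_monomial_of_coercive hε hS K3 x
  rw [eM, ← gibbsExpect_const_mul, eD,
    gibbsExpect_add J lam hI12 (hI b c (if d = x then (1 : ℝ) else 0)),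
    gibbsExpect_add J lam (hI c d (if b = x then (1 : ℝ) else 0))
      (hI b d (if c = x then (1 : ℝ) else 0)),
    gibbsExpect_const_mul, gibbsExpect_const_mul, gibbsExpect_const_mul] at h
  exact h

/-! ## The four-point hierarchy equation and Wick's theorem -/

/-- **The four-point Schwinger–Dyson (hierarchy) equation**, under coercivity:
`Σ_z (J_{xz} + J_{zx}) ⟨φ_z φ_b φ_c φ_d⟩ + 4λ ⟨φ_x³ φ_b φ_c φ_d⟩ = δ_{bx}⟨φ_cφ_d⟩ + δ_{cx}⟨φ_bφ_d⟩ +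
δ_{dx}⟨φ_bφ_c⟩`. -/
theorem gibbs_four_point_sd_of_coercive {J : Fin (n + 1) → Fin (n + 1) → ℝ} {lam ε K : ℝ}
    (hε : 0 < ε) (hS : ∀ φ : Fin (n + 1) → ℝ, ε * ∑ w, φ w ^ 2 - K ≤ latticePhi4Action J lam φ)
    (x b c d : Fin (n + 1)) :
    (∑ z, (J x z + J z x) * gibbsExpect J lam (fun φ => φ z * φ b * φ c * φ d))
        + 4 * lam * gibbsExpect J lam (fun φ => φ x ^ 3 * φ b * φ c * φ d)
      = (if b = x then (1 : ℝ) else 0) * gibbsExpect J lam (fun φ => φ c * φ d)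
        + (if c = x then (1 : ℝ) else 0) * gibbsExpect J lam (fun φ => φ b * φ d)
        + (if d = x then (1 : ℝ) else 0) * gibbsExpect J lam (fun φ => φ b * φ c) := by
  rw [← gibbs_sd_three_of_coercive hε hS x b c d]
  have hI := fun z m => integrable_four_mul_gibbsWeight_of_coercive hε hS z b c d m
  have e : (fun φ : Fin (n + 1) → ℝ => φ b * φ c * φ d * latticePhi4Force J lam φ x)
      = fun φ => (∑ z, (J x z + J z x) * (φ z * φ b * φ c * φ d))
          + 4 * lam * (φ x ^ 3 * φ b * φ c * φ d) := by
    funext φ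
    unfold latticePhi4Force
    rw [mul_add, Finset.mul_sum]
    congr 1
    · exact Finset.sum_congr rfl fun z _ => by ring
    · ring
  rw [e, gibbsExpect_add, gibbsExpect_sum, gibbsExpect_const_mul]
  · simp only [gibbsExpect_const_mul]
  · intro z _
    refine ((hI z 1).const_mul (J x z + J z x)).congr (Eventually.of_forall fun φ => ?_)
    simp only [pow_one]
    ring
  · refine (integrable_finsetSum Finset.univ fun z (_ : z ∈ Finset.univ) =>
      ((hI z 1).const_mul (J x z + J z x))).congr (Eventually.of_forall fun φ => ?_)
    simp only [Finset.sum_mul, pow_one]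
    exact Finset.sum_congr rfl fun z _ => by ring
  · refine ((hI x 3).const_mul (4 * lam)).congr (Eventually.of_forall fun φ => ?_)
    ring

/-- **The four-point hierarchy equation for `λ > 0`**, any real `J` (incl. tachyonic). -/
theorem gibbs_four_point_sd {lam : ℝ} (hlam : 0 < lam) (J : Fin (n + 1) → Fin (n + 1) → ℝ)
    (x b c d : Fin (n + 1)) :
    (∑ z, (J x z + J z x) * gibbsExpect J lam (fun φ => φ z * φ b * φ c * φ d))
        + 4 * lam * gibbsExpect J lam (fun φ => φ x ^ 3 * φ b * φ c * φ d)
      = (if b = x then (1 : ℝ) else 0) * gibbsExpect J lam (fun φ => φ c * φ d)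
        + (if c = x then (1 : ℝ) else 0) * gibbsExpect J lam (fun φ => φ b * φ d)
        + (if d = x then (1 : ℝ) else 0) * gibbsExpect J lam (fun φ => φ b * φ c) :=
  gibbs_four_point_sd_of_coercive one_pos (latticePhi4Action_coercive hlam J) x b c d

/-- **Wick's theorem (four-point function of the Gaussian lattice measure)**: for `λ = 0` and
`J + Jᵀ ≽ 2ε > 0`, with `G_{zy} = ⟨φ_z φ_y⟩`,
`⟨φ_a φ_b φ_c φ_d⟩ = G_{ab} G_{cd} + G_{ac} G_{bd} + G_{ad} G_{bc}` — derived from the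
hierarchy equation and `G (J + Jᵀ) = 1` alone. -/
theorem wick_four_point {J : Fin (n + 1) → Fin (n + 1) → ℝ} {ε : ℝ} (hε : 0 < ε)
    (hJ : ∀ φ : Fin (n + 1) → ℝ, ε * ∑ w, φ w ^ 2 ≤ ∑ x, ∑ y, φ x * J x y * φ y)
    (a b c d : Fin (n + 1)) :
    gibbsExpect J 0 (fun φ => φ a * φ b * φ c * φ d)
      = gibbsExpect J 0 (fun φ => φ a * φ b) * gibbsExpect J 0 (fun φ => φ c * φ d)
        + gibbsExpect J 0 (fun φ => φ a * φ c) * gibbsExpect J 0 (fun φ => φ b * φ d)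
        + gibbsExpect J 0 (fun φ => φ a * φ d) * gibbsExpect J 0 (fun φ => φ b * φ c) := by
  have hS := latticePhi4Action_coercive_of_quadForm_ge (J := J) le_rfl hJ
  -- the hierarchy equation at λ = 0
  have h4 : ∀ x, ∑ z, (J x z + J z x) * gibbsExpect J 0 (fun φ => φ z * φ b * φ c * φ d)
      = (if b = x then (1 : ℝ) else 0) * gibbsExpect J 0 (fun φ => φ c * φ d)
        + (if c = x then (1 : ℝ) else 0) * gibbsExpect J 0 (fun φ => φ b * φ d)
        + (if d = x then (1 : ℝ) else 0) * gibbsExpect J 0 (fun φ => φ b * φ c) := by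
    intro x
    have h := gibbs_four_point_sd_of_coercive hε hS x b c d
    simpa using h
  -- `G (J + Jᵀ) = 1`, entrywise
  have hGA : ∀ z, ∑ x, gibbsExpect J 0 (fun φ => φ a * φ x) * (J x z + J z x)
      = if a = z then (1 : ℝ) else 0 := by
    intro z
    have hmat := mul_eq_one_comm.mp (free_propagator_mul hε hJ)
    have h := congrFun (congrFun hmat a) z
    rw [Matrix.mul_apply, Matrix.one_apply] at h
    simpa only [Matrix.add_apply, Matrix.transpose_apply, Matrix.of_apply] using h
  -- contract the hierarchy equation with `G_{a·}`
  have step1 : gibbsExpect J 0 (fun φ => φ a * φ b * φ c * φ d)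
      = ∑ z, (if a = z then (1 : ℝ) else 0) *
          gibbsExpect J 0 (fun φ => φ z * φ b * φ c * φ d) := by
    simp only [ite_mul, one_mul, zero_mul, Finset.sum_ite_eq, Finset.mem_univ, if_true]
  have step2 : ∑ z, (if a = z then (1 : ℝ) else 0) *
          gibbsExpect J 0 (fun φ => φ z * φ b * φ c * φ d)
      = ∑ x, gibbsExpect J 0 (fun φ => φ a * φ x) *
          ∑ z, (J x z + J z x) * gibbsExpect J 0 (fun φ => φ z * φ b * φ c * φ d) := by
    rw [Finset.sum_congr rfl fun z _ => by rw [← hGA z]]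
    simp only [Finset.sum_mul, Finset.mul_sum]
    rw [Finset.sum_comm]
    exact Finset.sum_congr rfl fun x _ => Finset.sum_congr rfl fun z _ => by ring
  rw [step1, step2, Finset.sum_congr rfl fun x _ => by rw [h4 x]]
  simp only [mul_add, Finset.sum_add_distrib, mul_ite, mul_zero, ite_mul, zero_mul,
    Finset.sum_ite_eq, Finset.mem_univ, if_true]
  ring

end Wick

end Summit.Ventures.LatticeQCDFlow.Scoring
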